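import Mathlib
import Literature.AlgebraicGeometry.Resolution.DefectTransport
import Literature.AlgebraicGeometry.Resolution.GeneralizedStabilityRankOneVTGalois
import Literature.AlgebraicGeometry.Resolution.HenselizedFunctionFieldsBaseChangeLemmas
import Literature.AlgebraicGeometry.Resolution.ResidueRoots
import Literature.AlgebraicGeometry.Resolution.HenselizationHenselian
import Literature.AlgebraicGeometry.Resolution.OstrowskiHenselian
import Literature.AlgebraicGeometry.Resolution.HenselizedRationalImmediateExtProofs
import Literature.RingTheory.MvPolynomial.NoetherFormsGenericRoot
import Summits.ResolutionOfSingularities.ResolutionOfSingularities.Theorems.DefectlessFramesDefectlessFramesRTwistSubst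

/-!
# Hensel cluster budget and Ostrowski: defectlessness for small axis order (stub `stub_dfrSmallAxis`)

Crux `DefectlessFramesR`, line `Sketch`. Let `(y'; z'; f')` be a hypersurface frame of `K/k` at the valuation
ring `O ⊇ k` of `K` (`k(y', z') = K`, `(f') = ker (k[X_0, …, X_n] → K)`), in general position (the axis
polynomial `f'(ȳ', X) ∈ κ(O)[X]` is non-zero) with axis order `s' = mult_{z̄'} f'(ȳ', X) < p`. For an algebraic
closure `Ω ⊇ K`, a valuation ring `V` of `Ω` over `O`, `F = k(y') ⊆ Ω` and its henselization `F^h`, we prove that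
`F^h · K = F^h(z')` is a defectless extension of `F^h` (`IsDefectlessExtension`).

* **Cluster budget** (`dfrSmallAxis_natDegree_minpoly_le`). The relation polynomial `q = f'(y', X)` has
  coefficients in `V ∩ F` and reduces to the axis polynomial. Over the henselian `F^h`
  (`Kuhlmann2010HenselizationIsHenselian_holds`) the `F^h`-conjugates of `z'` lie in `V`, and conjugation does
  not change values modulo `𝔪_V` (`IsHenselianField.aeval_mem_iff_of_aeval_minpoly`); applied to the Hasse
  derivatives of `q` this shows that the reduction `q̄` has multiplicity exactly `s'` at the residue of every
  conjugate, and applied to a lift of `φ = minpoly_{F^h v}(z̄')` that these residues are roots of `φ`. Since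
  `minpoly_{F^h}(z')` divides `q` over `V`, at most `s'` conjugates (with multiplicity) share a residue, whence
  `m = [F^h(z') : F^h] ≤ s' · deg φ ≤ s' · f`.
* **Ostrowski** (`exists_relFinrank_eq_mul_pow_of_isHenselianField`): `m = e · f · p^ν`; with the bridge
  `dfrSmallAxis_rel_eq` between the typed and the ambient `e`, `f` this gives `e · p^ν ≤ s' < p`, so `ν = 0`
  and `m = e · f`.
-/

namespace Summit.ResolutionOfSingularities.ResolutionOfSingularities.Theorems

open Polynomial IsLocalRing Literature.AlgebraicGeometry.Resolution Literature.RingTheory.MvPolynomial.NoetherForms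

/-- Root multiplicities are determined by the vanishing pattern of the Hasse derivatives (the coefficients
of the Taylor expansion). [folklore] -/
theorem dfrSmallAxis_rootMultiplicity_eq_of_iff {R : Type*} [CommRing R] (p : R[X]) (a b : R)
    (h : ∀ j, (hasseDeriv j p).eval a = 0 ↔ (hasseDeriv j p).eval b = 0) :
    p.rootMultiplicity a = p.rootMultiplicity b := by
  have hs : (taylor a p).support = (taylor b p).support := by
    ext j
    simp only [mem_support_iff, taylor_coeff, ne_eq, h j]
  rw [rootMultiplicity_eq_natTrailingDegree, rootMultiplicity_eq_natTrailingDegree, ← taylor_apply,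
    ← taylor_apply]
  simp only [natTrailingDegree, trailingDegree, hs]

/-- For subfields `M ≤ N` of `(Ω, V)`, the typed invariants `e(N|M)`, `f(N|M)` are the relative index of the
value subgroups `vM ≤ vN` and the relative degree of the residue subfields `Mv ≤ Nv`. [folklore] -/
theorem dfrSmallAxis_rel_eq {Ω : Type*} [Field Ω] (V : ValuationSubring Ω) {M N : Subfield Ω}
    (h : M ≤ N) :
    relRamificationIndex V M N h = (valueSubgroup M V).relIndex (valueSubgroup N V) ∧
      relInertiaDegree V M N h = (residueSubfield M V).relfinrank (residueSubfield N V) := by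
  letI : Algebra M N := (Subfield.inclusion h).toAlgebra
  haveI : IsScalarTower M N Ω := IsScalarTower.of_algebraMap_eq fun _ => rfl
  set B : IntermediateField M Ω := Subfield.extendScalars h with hB
  let ψ : N ≃+* B :=
    { toFun := fun z => ⟨z.1, z.2⟩
      invFun := fun z => ⟨z.1, z.2⟩
      left_inv := fun _ => rfl
      right_inv := fun _ => rfl
      map_mul' := fun _ _ => rfl
      map_add' := fun _ _ => rfl }
  have hc : ∀ x : M, ψ (algebraMap M N x) = algebraMap M B ((RingEquiv.refl M) x) := fun x =>
    Subtype.ext rfl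
  have hW : V.comap (algebraMap N Ω) = (V.comap (algebraMap B Ω)).comap ψ.toRingHom := by
    ext z
    rfl
  have hrange : Set.range (algebraMap B Ω) = Set.range (algebraMap N Ω) := by
    rw [range_algebraMap_intermediateField, range_algebraMap_subfield, hB, Subfield.coe_extendScalars]
  rw [relRamificationIndex_eq V h, relInertiaDegree_eq V h, ramificationIndex_congr (RingEquiv.refl M) ψ hc hW,
    inertiaDegree_congr (RingEquiv.refl M) ψ hc hW, ramificationIndex_comap_eq_relIndex,
    inertiaDegree_comap_eq_relfinrank, valueSubgroup_eq_of_range_eq V hrange,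
    residueSubfield_eq_of_range_eq V hrange]
  exact ⟨rfl, rfl⟩

/-- **Evaluation of Hasse derivatives through `V`.** If `qL ∈ L[X]` (`L ≤ Ω` a subfield) and `qV ∈ V[X]` have
the same image in `Ω[X]`, then for `w ∈ V` and every `j`: `v((D^{(j)} qL)(w)) < 1` iff the `j`-th Hasse
derivative of the reduction `q̄ = qV mod 𝔪_V` vanishes at `w̄`. [folklore] -/
theorem dfrSmallAxis_valuation_hasseDeriv_lt_one_iff {Ω : Type*} [Field Ω] (V : ValuationSubring Ω)
    {L : Subfield Ω} (qL : Polynomial L) (qV : Polynomial V)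
    (hq : qL.map (algebraMap L Ω) = qV.map (algebraMap V Ω)) (w : V) (j : ℕ) :
    V.valuation (aeval (w : Ω) (hasseDeriv j qL)) < 1 ↔
      (hasseDeriv j (qV.map (residue V))).eval (residue V w) = 0 := by
  have e1 : aeval (w : Ω) (hasseDeriv j qL) = (((hasseDeriv j qV).eval w : V) : Ω) := by
    rw [aeval_def, ← eval_map, ← hasseDeriv_map, hq, hasseDeriv_map, eval_map]
    exact eval₂_at_apply (algebraMap V Ω) w
  rw [e1, show (((hasseDeriv j qV).eval w : V) : Ω) = ((hasseDeriv j qV).eval w : V) from rfl,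
    ← ValuationSubring.valuation_lt_one_iff, ← residue_eq_zero_iff, hasseDeriv_map, eval_map]
  rw [eval₂_at_apply (residue V) w]

/-- **Hensel cluster budget.** Let `L ≤ Ω` (`Ω` algebraically closed) be henselian for `V ∩ L`, `qL ∈ L[X]` and
`qV ∈ V[X]` with the same image in `Ω[X]` and non-zero reduction `q̄ ∈ Ωv[X]`, `ζ ∈ V` a root of `qL` with
residue `θ`, and `φ ≠ 0` a polynomial over the residue field `Lv` vanishing at `θ`. Then
`deg minpoly_L(ζ) ≤ deg φ · mult_θ(q̄)`: the `L`-conjugates of `ζ` lie in `V` with residues among the roots of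
`φ`, at each such residue `q̄` has multiplicity `mult_θ(q̄)` (Hasse derivatives and
`IsHenselianField.aeval_mem_iff_of_aeval_minpoly`), and `minpoly_L(ζ)` divides `qV` over `V`, so at most
`mult_θ(q̄)` conjugates (counted with multiplicity) share a residue. [folklore] -/
theorem dfrSmallAxis_natDegree_minpoly_le {Ω : Type*} [Field Ω] [IsAlgClosed Ω] (V : ValuationSubring Ω)
    {L : Subfield Ω} (hL : IsHenselianField L (V.comap (algebraMap L Ω))) (qL : Polynomial L)
    (qV : Polynomial V) (hq : qL.map (algebraMap L Ω) = qV.map (algebraMap V Ω))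
    (hq0 : qV.map (residue V) ≠ 0) {ζ : Ω} (hζV : ζ ∈ V) (hζ : aeval ζ qL = 0)
    (φ : Polynomial (residueSubfield L V)) (hφ0 : φ ≠ 0) (hφ : aeval (residue V ⟨ζ, hζV⟩) φ = 0) :
    (minpoly L ζ).natDegree ≤
      φ.natDegree * (qV.map (residue V)).rootMultiplicity (residue V ⟨ζ, hζV⟩) := by
  classical
  have hqV0 : qV ≠ 0 := fun h => hq0 (by rw [h, Polynomial.map_zero])
  have hqΩ0 : qV.map (algebraMap V Ω) ≠ 0 := (Polynomial.map_ne_zero_iff Subtype.val_injective).mpr hqV0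
  have hqL0 : qL ≠ 0 := fun h => hqΩ0 (by rw [← hq, h, Polynomial.map_zero])
  have haint : IsIntegral L ζ := IsAlgebraic.isIntegral ⟨qL, hqL0, hζ⟩
  set ν := minpoly L ζ with hνdef
  set νΩ := ν.map (algebraMap L Ω) with hνΩdef
  have hνmon : νΩ.Monic := (minpoly.monic haint).map _
  have hν0 : νΩ ≠ 0 := hνmon.ne_zero
  -- the roots of `ν` lie in `V`
  have hrootsV : ∀ r ∈ νΩ.roots, r ∈ V := fun r hr =>
    hL.mem_of_aeval_minpoly V haint (by rw [aeval_def, ← eval_map]; exact (mem_roots hν0).mp hr) hζV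
  obtain ⟨s, hs⟩ : ∃ s : Multiset V, s.map Subtype.val = νΩ.roots :=
    ⟨νΩ.roots.attach.map fun r => ⟨r.1, hrootsV r.1 r.2⟩, by
      rw [Multiset.map_map]
      exact Multiset.attach_map_val _⟩
  have hroot_of_mem : ∀ r ∈ s, aeval (r : Ω) ν = 0 := fun r hr => by
    have hrroot : (r : Ω) ∈ νΩ.roots := by
      rw [← hs]
      exact Multiset.mem_map_of_mem _ hr
    have h := (mem_roots hν0).mp hrroot
    rwa [IsRoot.def, eval_map, ← aeval_def] at h
  set S := s.map (residue V) with hSdef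
  have hcard : Multiset.card S = ν.natDegree := by
    rw [hSdef, Multiset.card_map, ← Multiset.card_map Subtype.val, hs,
      ← (IsAlgClosed.splits _).natDegree_eq_card_roots,
      natDegree_map_eq_of_injective (algebraMap L Ω).injective]
  set θ := residue V ⟨ζ, hζV⟩ with hθdef
  set qbar := qV.map (residue V) with hqbardef
  -- (A) `q̄` has the same multiplicity at the residue of every conjugate
  have hmult : ∀ r ∈ s, qbar.rootMultiplicity (residue V r) = qbar.rootMultiplicity θ := by
    intro r hr
    refine dfrSmallAxis_rootMultiplicity_eq_of_iff qbar _ _ fun j => ?_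
    rw [hqbardef, ← dfrSmallAxis_valuation_hasseDeriv_lt_one_iff V qL qV hq r j,
      ← dfrSmallAxis_valuation_hasseDeriv_lt_one_iff V qL qV hq ⟨ζ, hζV⟩ j]
    exact ((hL.aeval_mem_iff_of_aeval_minpoly V haint (hroot_of_mem r hr) (hasseDeriv j qL)).2).symm
  -- (B) the residues of the conjugates are roots of `φ`
  obtain ⟨Φ, hΦ⟩ := exists_lift_of_residueSubfield V L φ
  have hΦζ : V.valuation (aeval ζ Φ) < 1 := (hΦ ζ hζV).2.mpr hφ
  set φv := φ.map (algebraMap (residueSubfield L V) (ResidueField V)) with hφvdef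
  have hφv0 : φv ≠ 0 :=
    (Polynomial.map_ne_zero_iff (algebraMap (residueSubfield L V) (ResidueField V)).injective).mpr hφ0
  have hrootφ : ∀ b ∈ S, b ∈ φv.roots := by
    intro b hb
    obtain ⟨r, hr, rfl⟩ := Multiset.mem_map.mp hb
    have h1 := (hL.aeval_mem_iff_of_aeval_minpoly V haint (hroot_of_mem r hr) Φ).2.mp hΦζ
    have h2 := (hΦ r r.2).2.mp h1
    rw [mem_roots hφv0, IsRoot.def, hφvdef, eval_map, ← aeval_def]
    exact h2
  -- (C) `ν ∣ q` over `V`, so residues of conjugates are counted by root multiplicities of `q̄`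
  set νV : Polynomial V := (s.map fun r => X - C r).prod with hνVdef
  have hνVmon : νV.Monic := monic_multiset_prod_of_monic _ _ fun r _ => monic_X_sub_C r
  have hνV : νV.map (algebraMap V Ω) = νΩ := by
    have h1 : νV.map (algebraMap V Ω) = ((s.map Subtype.val).map fun ρ : Ω => X - C ρ).prod := by
      rw [hνVdef, Polynomial.map_multiset_prod, Multiset.map_map, Multiset.map_map]
      congr 1
      refine Multiset.map_congr rfl fun r _ => ?_
      simp only [Function.comp_apply, Polynomial.map_sub, Polynomial.map_X, Polynomial.map_C]
      rfl
    rw [h1, hs, ← (IsAlgClosed.splits νΩ).eq_prod_roots_of_monic hνmon]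
  have hdvd : νV ∣ qV := by
    rw [← modByMonic_eq_zero_iff_dvd hνVmon]
    apply Polynomial.map_injective (algebraMap V Ω) Subtype.val_injective
    rw [Polynomial.map_modByMonic _ hνVmon, hνV, Polynomial.map_zero, ← hq,
      modByMonic_eq_zero_iff_dvd hνmon, hνΩdef, hνdef]
    exact Polynomial.map_dvd _ (minpoly.dvd L ζ hζ)
  have hνbar : (νV.map (residue V)).roots = S := (map_residue_eq_prod V rfl).2
  have hcount : ∀ b, S.count b ≤ qbar.rootMultiplicity b := fun b => by
    rw [← hνbar, ← count_roots]
    exact Multiset.count_le_of_le b (roots.le_of_dvd hq0 (Polynomial.map_dvd _ hdvd))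
  -- (D) counting
  have hdist : S.toFinset.card ≤ φ.natDegree :=
    calc S.toFinset.card ≤ φv.roots.toFinset.card :=
          Finset.card_le_card fun b hb =>
            Multiset.mem_toFinset.mpr (hrootφ b (Multiset.mem_toFinset.mp hb))
      _ ≤ Multiset.card φv.roots := Multiset.toFinset_card_le _
      _ ≤ φv.natDegree := card_roots' _
      _ = φ.natDegree :=
          natDegree_map_eq_of_injective (algebraMap (residueSubfield L V) (ResidueField V)).injective φ
  have hsum : ∑ b ∈ S.toFinset, S.count b ≤ ∑ b ∈ S.toFinset, qbar.rootMultiplicity θ := by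
    refine Finset.sum_le_sum fun b hb => ?_
    obtain ⟨r, hr, rfl⟩ := Multiset.mem_map.mp (Multiset.mem_toFinset.mp hb)
    rw [← hmult r hr]
    exact hcount _
  calc ν.natDegree = Multiset.card S := hcard.symm
    _ = ∑ b ∈ S.toFinset, S.count b := (Multiset.toFinset_sum_count_eq S).symm
    _ ≤ ∑ b ∈ S.toFinset, qbar.rootMultiplicity θ := hsum
    _ = S.toFinset.card * qbar.rootMultiplicity θ := by rw [Finset.sum_const, smul_eq_mul]
    _ ≤ φ.natDegree * qbar.rootMultiplicity θ := Nat.mul_le_mul_right _ hdist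

/-- **Hensel cluster budget + Ostrowski** (stub `stub_dfrSmallAxis` of crux `DefectlessFramesR`, line `Sketch`).
For a hypersurface frame `(y'; z'; f')` of `K/k` at `O` in general position with axis order
`s' = mult_{z̄'} f'(ȳ', X) < p`, and every valuation ring `V` over `O` of an algebraic closure `Ω ⊇ K`: with
`F = k(y') ⊆ Ω` and `F^h` its henselization, `F^h·K = F^h(z')` is a defectless extension of `F^h`. Indeed
`m = [F^h(z') : F^h] ≤ s'·deg minpoly_{F^h v}(z̄') ≤ s'·f` (cluster budget: the `F^h`-conjugates of `z'` have
residues conjugate to `z̄'`, at each of which the reduction `f'(ȳ', X)` has multiplicity `s'`), while Ostrowski's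
lemma over the henselian `F^h` gives `m = e·f·p^ν`; so `e·p^ν ≤ s' < p`, `ν = 0`, `m = e·f`. [folklore] -/
theorem stub_dfrSmallAxis : ∀ p : ℕ, p.Prime → ∀ (k K : Type) [Field k] [CharP k p] [PerfectField k] [Field K] [Algebra k K], (⊤ : IntermediateField k K).FG → ∀ O : ValuationSubring K, ∀ hk : (∀ c : k, algebraMap k K c ∈ O), Nonempty O.valuation.RankOne → (∀ x ∈ O, ∃ f : Polynomial k, f ≠ 0 ∧ Polynomial.aeval x f ∈ O.nonunits) → let ρ : k →+* IsLocalRing.ResidueField O := (IsLocalRing.residue O).comp ((algebraMap k K).codRestrict O hk); let axis : (m : ℕ) → (Fin m → O) → MvPolynomial (Fin (m + 1)) k → Polynomial (IsLocalRing.ResidueField O) := fun _ w g => MvPolynomial.eval₂ (Polynomial.C.comp ρ) (Fin.snoc (fun j => Polynomial.C (IsLocalRing.residue O (w j))) Polynomial.X) g; ∀ (n : ℕ) (y' : Fin n → O) (z' : O) (f' : MvPolynomial (Fin (n + 1)) k), AlgebraicIndependent k (fun i => (y' i : K)) → IsIntegral (Algebra.adjoin k (Set.range fun i => (y' i : K)))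 (z' : K) → IntermediateField.adjoin k (Set.range (fun i => (y' i : K)) ∪ {(z' : K)}) = ⊤ → Ideal.span {f'} = RingHom.ker (MvPolynomial.aeval (Fin.snoc (fun i => (y' i : K)) (z' : K)) : MvPolynomial (Fin (n + 1)) k →ₐ[k] K) → axis n y' f' ≠ 0 → IsSeparable (IntermediateField.adjoin k (Set.range fun i => (y' i : K))) (z' : K) → (axis n y' f').rootMultiplicity (IsLocalRing.residue O z') < p → ∀ (Ω : Type) [Field Ω] [Algebra K Ω] [IsAlgClosure K Ω] (V : ValuationSubring Ω), V.comap (algebraMap K Ω) = O → let F : Subfield Ω := (IntermediateField.adjoin k (Set.range fun i => (y' i : K))).toSubfield.map (algebraMap K Ω); Literature.AlgebraicGeometry.Resolution.IsDefectlessExtension V (Literature.AlgebraicGeometry.Resolution.henselization V F) (Literature.AlgebraicGeometry.Resolution.henselization V F ⊔ (algebraMap K Ω).fieldRange) := by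
  intro p hp k K _ _ _ _ _ _hfg O hk _hR _hZ ρ axis n y' z' f' _hy _hint hadj hker hax _hsep hs Ω _ _ _ V hVO F
  classical
  haveI : IsAlgClosed Ω := IsAlgClosure.isAlgClosed K
  subst hVO
  -- the fields
  set Fh : Subfield Ω := henselization V F with hFhdef
  have hL : IsHenselianField Fh (V.comap (algebraMap Fh Ω)) :=
    Kuhlmann2010HenselizationIsHenselian_holds Ω V F
  have hFFh : F ≤ Fh := le_henselization V F
  set ζ : Ω := algebraMap K Ω z' with hζdef
  have hζV : ζ ∈ V := z'.2
  have hFmem : ∀ x ∈ IntermediateField.adjoin k (Set.range fun i => (y' i : K)), algebraMap K Ω x ∈ F :=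
    fun x hx => Subfield.mem_map.mpr ⟨x, hx, rfl⟩
  have hkF : ∀ c : k, algebraMap K Ω (algebraMap k K c) ∈ F := fun c =>
    hFmem _ (IntermediateField.algebraMap_mem _ c)
  have hyF : ∀ i, algebraMap K Ω (y' i) ∈ F := fun i =>
    hFmem _ (IntermediateField.subset_adjoin k _ ⟨i, rfl⟩)
  -- the relation polynomial in its avatars over `V`, `F^h`, `Ω`, and its reduction, the axis polynomial
  set P₀ : (MvPolynomial (Fin n) k)[X] :=
    ((MvPolynomial.renameEquiv k finSuccEquivLast).trans (MvPolynomial.optionEquivLeft k (Fin n))) f' with hP₀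
  set ιk : k →+* V.comap (algebraMap K Ω) := (algebraMap k K).codRestrict _ hk with hιk
  set ψO : MvPolynomial (Fin n) k →+* V.comap (algebraMap K Ω) := MvPolynomial.eval₂Hom ιk y' with hψO
  set ψV : MvPolynomial (Fin n) k →+* V := (comapSubringHom K V).comp ψO with hψV
  set φΩ : k →+* Ω := (algebraMap K Ω).comp (algebraMap k K) with hφΩ
  set ψL : MvPolynomial (Fin n) k →+* Fh := MvPolynomial.eval₂Hom (φΩ.codRestrict Fh fun c => hFFh (hkF c))
    (fun i => ⟨algebraMap K Ω (y' i), hFFh (hyF i)⟩) with hψL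
  set qV : V[X] := P₀.map ψV with hqV
  set qL : Fh[X] := P₀.map ψL with hqL
  have hψΩV : (algebraMap V Ω).comp ψV = MvPolynomial.eval₂Hom φΩ (fun i => algebraMap K Ω (y' i)) :=
    MvPolynomial.ringHom_ext (fun c => by simp [hψV, hψO, hιk, hφΩ]) (fun i => by simp [hψV, hψO])
  have hψΩL : (algebraMap Fh Ω).comp ψL = MvPolynomial.eval₂Hom φΩ (fun i => algebraMap K Ω (y' i)) :=
    MvPolynomial.ringHom_ext (fun c => by simp [hψL]; rfl) (fun i => by simp [hψL]; rfl)
  have hq : qL.map (algebraMap Fh Ω) = qV.map (algebraMap V Ω) := by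
    rw [hqL, hqV, Polynomial.map_map, Polynomial.map_map, hψΩL, hψΩV]
  have hρO : (residue _).comp ψO = MvPolynomial.eval₂Hom ρ (fun j => residue _ (y' j)) :=
    MvPolynomial.ringHom_ext (fun c => by simp [hψO]; rfl) (fun i => by simp [hψO])
  have haxis : axis n y' f' = P₀.map ((residue _).comp ψO) := by
    show MvPolynomial.eval₂ (Polynomial.C.comp ρ)
      (Fin.snoc (fun j => Polynomial.C (residue _ (y' j))) Polynomial.X) f' = _
    rw [dfrTwist_axis_eq_map, hρO]
  have hqbar : qV.map (residue V) = (axis n y' f').map (residueFieldHom K V) := by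
    rw [haxis, hqV, Polynomial.map_map, Polynomial.map_map]
    exact congrArg (fun φ => P₀.map φ) (RingHom.ext fun g => (residueFieldHom_residue K V (ψO g)).symm)
  have hqbar0 : qV.map (residue V) ≠ 0 := by
    rw [hqbar]
    exact (Polynomial.map_ne_zero_iff (residueFieldHom K V).injective).mpr hax
  have hθ : residue V ⟨ζ, hζV⟩ = residueFieldHom K V (residue _ z') := by
    rw [residueFieldHom_residue]
    rfl
  have hmultθ : (qV.map (residue V)).rootMultiplicity (residue V ⟨ζ, hζV⟩) =
      (axis n y' f').rootMultiplicity (residue _ z') := by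
    rw [hqbar, hθ, ← eq_rootMultiplicity_map (residueFieldHom K V).injective]
  -- `ζ` is a root of `qL`
  have hζq : aeval ζ qL = 0 := by
    have h1 : MvPolynomial.aeval (Fin.snoc (fun i => (y' i : K)) (z' : K)) f' = 0 := by
      rw [← RingHom.mem_ker, ← hker]
      exact Ideal.mem_span_singleton_self f'
    have h2 := congrArg (algebraMap K Ω) h1
    rw [map_zero, MvPolynomial.aeval_def, MvPolynomial.eval₂_comp_left, Fin.comp_snoc] at h2
    rw [aeval_def, ← eval_map, hqL, Polynomial.map_map, hψΩL, hP₀, eval_map, dfrTwist_eval₂_fin]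
    exact h2
  -- `F^h · K = F^h(ζ)`
  set T : Subfield Ω := Fh ⊔ (algebraMap K Ω).fieldRange with hTdef
  set Fhζ : Subfield Ω := (IntermediateField.adjoin Fh ({ζ} : Set Ω)).toSubfield with hFhζdef
  have hFhT : Fh ≤ T := le_sup_left
  have hζT : ζ ∈ T := (le_sup_right : (algebraMap K Ω).fieldRange ≤ T) (RingHom.mem_fieldRange.mpr ⟨z', rfl⟩)
  have hTeq : T = Fhζ := by
    refine le_antisymm (sup_le (subfield_le_toSubfield _) fun x hx => ?_) (adjoin_simple_toSubfield_le hFhT hζT)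
    obtain ⟨w, rfl⟩ := RingHom.mem_fieldRange.mp hx
    have hFFhζ : F ≤ Fhζ := hFFh.trans (subfield_le_toSubfield _)
    let J : IntermediateField k K :=
      (Fhζ.comap (algebraMap K Ω)).toIntermediateField fun c => Subfield.mem_comap.mpr (hFFhζ (hkF c))
    have hJ : IntermediateField.adjoin k (Set.range (fun i => (y' i : K)) ∪ {(z' : K)}) ≤ J := by
      rw [IntermediateField.adjoin_le_iff]
      rintro x (⟨i, rfl⟩ | hx)
      · exact Subfield.mem_comap.mpr (hFFhζ (hyF i))
      · rw [Set.mem_singleton_iff.mp hx]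
        exact Subfield.mem_comap.mpr (IntermediateField.mem_adjoin_simple_self Fh ζ)
    have hw : w ∈ J := hJ (show w ∈ IntermediateField.adjoin k _ by rw [hadj]; trivial)
    exact Subfield.mem_comap.mp hw
  -- degrees
  have hqV0 : qV ≠ 0 := fun h => hqbar0 (by rw [h, Polynomial.map_zero])
  have hqL0 : qL ≠ 0 := fun h =>
    (Polynomial.map_ne_zero_iff Subtype.val_injective).mpr hqV0 (by rw [← hq, h, Polynomial.map_zero])
  have haint : IsIntegral Fh ζ := IsAlgebraic.isIntegral ⟨qL, hqL0, hζq⟩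
  have hm : Subfield.relfinrank Fh T = (minpoly Fh ζ).natDegree := by
    rw [hTeq]
    exact relfinrank_adjoin_simple_eq_natDegree Fh haint
  have hpos : 0 < Subfield.relfinrank Fh T := by
    rw [hm]
    exact minpoly.natDegree_pos haint
  obtain ⟨heA, hfA, -⟩ := relIndex_mul_relfinrank_le_relfinrank V hFhT hpos
  -- the residue `θ = z̄'` inside `(F^h·K)v`, its degree over `F^h v` is at most `f`
  have hθT : residue V ⟨ζ, hζV⟩ ∈ residueSubfield T V := residue_mem_residueSubfield T V ⟨ζ, hζT⟩ hζV
  have hκle : residueSubfield Fh V ≤ residueSubfield T V := residueSubfield_subfield_mono hFhT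
  have hθint : IsIntegral (residueSubfield Fh V) (residue V ⟨ζ, hζV⟩) :=
    (isAlgebraic_of_relfinrank_pos hκle hfA hθT).isIntegral
  set φ := minpoly (residueSubfield Fh V) (residue V ⟨ζ, hζV⟩) with hφdef
  set Evθ : Subfield (ResidueField V) := (IntermediateField.adjoin (residueSubfield Fh V)
    ({residue V ⟨ζ, hζV⟩} : Set (ResidueField V))).toSubfield with hEvθdef
  have h1 : residueSubfield Fh V ≤ Evθ := subfield_le_toSubfield _
  have h2 : Evθ ≤ residueSubfield T V := adjoin_simple_toSubfield_le hκle hθT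
  have hEvθ_deg : Subfield.relfinrank (residueSubfield Fh V) Evθ = φ.natDegree :=
    relfinrank_adjoin_simple_eq_natDegree _ hθint
  have htower := Subfield.relfinrank_mul_relfinrank h1 h2
  have hf_ge : φ.natDegree ≤ (residueSubfield Fh V).relfinrank (residueSubfield T V) := by
    rw [← hEvθ_deg, ← htower]
    refine Nat.le_mul_of_pos_right _ ?_
    rcases Nat.eq_zero_or_pos (Subfield.relfinrank Evθ (residueSubfield T V)) with h0 | h0
    · rw [h0, mul_zero] at htower
      omega
    · exact h0
  -- the cluster budget `m ≤ deg φ · s'`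
  have hbudget := dfrSmallAxis_natDegree_minpoly_le V hL qL qV hq hqbar0 hζV hζq φ (minpoly.ne_zero hθint)
    (minpoly.aeval _ _)
  rw [hmultθ, ← hm] at hbudget
  -- Ostrowski `m = e · f · p ^ ν`
  have hfin : RelFinite Fh T hFhT := relFinite_of_relfinrank_pos hFhT hpos
  obtain ⟨ν, hν⟩ := exists_relFinrank_eq_mul_pow_of_isHenselianField V hFhT hL hfin
  obtain ⟨he, hf⟩ := dfrSmallAxis_rel_eq V hFhT
  haveI : CharP (ResidueField V) p :=
    charP_of_injective_ringHom ((residue V).comp ((comapSubringHom K V).comp ιk)).injective p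
  haveI : ExpChar (ResidueField V) p := ExpChar.prime hp
  rw [relFinrank_eq_relfinrank hFhT, he, hf, ringExpChar.eq (ResidueField V) p] at hν
  -- `e · p ^ ν ≤ s' < p`, so `ν = 0`
  have hν0 : ν = 0 := by
    by_contra hne
    have hppow : p ≤ p ^ ν := by
      calc p = p ^ 1 := (pow_one p).symm
        _ ≤ p ^ ν := Nat.pow_le_pow_right hp.pos (Nat.one_le_iff_ne_zero.mpr hne)
    have key : (valueSubgroup (↥Fh) V).relIndex (valueSubgroup (↥T) V) * p ^ ν *
        (residueSubfield (↥Fh) V).relfinrank (residueSubfield (↥T) V) ≤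
        (axis n y' f').rootMultiplicity (residue _ z') *
          (residueSubfield (↥Fh) V).relfinrank (residueSubfield (↥T) V) := by
      calc _ = Subfield.relfinrank Fh T := by rw [hν]; ring
        _ ≤ φ.natDegree * (axis n y' f').rootMultiplicity (residue _ z') := hbudget
        _ ≤ (residueSubfield (↥Fh) V).relfinrank (residueSubfield (↥T) V) *
              (axis n y' f').rootMultiplicity (residue _ z') := Nat.mul_le_mul_right _ hf_ge
        _ = _ := mul_comm _ _
    have key' := Nat.le_of_mul_le_mul_right key hfA
    have : p ≤ (axis n y' f').rootMultiplicity (residue _ z') :=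
      calc p ≤ p ^ ν := hppow
        _ ≤ (valueSubgroup (↥Fh) V).relIndex (valueSubgroup (↥T) V) * p ^ ν := Nat.le_mul_of_pos_left _ heA
        _ ≤ _ := key'
    omega
  refine ⟨hFhT, hpos, ?_⟩
  rw [hν, hν0, pow_zero, mul_one]

end Summit.ResolutionOfSingularities.ResolutionOfSingularities.Theorems
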